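import Summits.CriticalPhenomena.PercolationContinuityZ3.Theses.PercTwoPointDecay
import Summits.CriticalPhenomena.PercolationContinuityZ3.Theses.PercShatteringRace
import Summits.CriticalPhenomena.PercolationContinuityZ3.Theses.PercHyperscalingGluing
import Summits.CriticalPhenomena.PercolationContinuityZ3.Theorems.FreeBoxPowerSaving.Negative.FreeBoxPowerSavingOneArm
import HarnessLib

/-!
# Crux `PercTwoPointDecay.CritBallAverageDecay` = X_A (stmt-CriticalPhenomena-0833) — split glue:
# `X_A ⇐ FreeSusceptibilityPowerSaving ∧ BoxGluing`

Crux-strategist file (unit `cstrat-stmt-CriticalPhenomena-0833-r1`, BC2-redirect of the RESTATED deciding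
crux of route `PercTwoPointDecay`), `--supports stmt-CriticalPhenomena-0833`.  The deciding crux

  X_A = `CritBallAverageDecay`: `∃ a > 0, C, ∀ R ≥ 1, Σ_{x ∈ Λ_R} τ_{p_c}(0,x) ≤ C R^{3-a}`  (Λ_R = box 3 R)

is at least the conjunct (`τ ≥ θ²`).  It is decomposed here into two pieces that are ITEMS OF THE TREE,
each compatible on its own with a jump `θ(p_c) > 0` (so neither gives the Statement or X_A alone):

* S(1/2) = `PercShatteringRace.FreeSusceptibilityPowerSaving` (stmt-CriticalPhenomena-5786) — the in-box
  (free-boundary) rate `Σ_{y ∈ Λ_R} P_{p_c}(0 ↔ y inside Λ_R) ≤ C' R^{5/2}` (a SHATTERED jump world satisfies it);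
* `PercHyperscalingGluing.BoxGluing` (stmt-CriticalPhenomena-4643) — the open half of hyperscaling,
  `π_{p_c}(n)² ≤ C |Λ_n|⁻¹ Σ_{x ∈ Λ_n} P_{p_c}(0 ↔ x inside Λ_{Kn})` (a MONOLITHIC jump world satisfies it).

Glue (`critBallAverageDecay_of_subs`, the theorem named by `route edit --split … --glue-by`):
`π_n² ≤ C|Λ_n|⁻¹ Σ_{Λ_n} τ^{Λ_{Kn}} ≤ C|Λ_n|⁻¹ Σ_{Λ_{Kn}} τ^{Λ_{Kn}} ≤ C (2n+1)⁻³ C' (Kn)^{5/2} ≤ (C|C'|K^{5/2}) n^{-1/2}`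
(`oneArmProb_sq_le_of_subs`), hence the one-arm rate `π_{p_c}(n) ≤ √M · n^{-1/4}` (`oneArmProb_le_of_subs`),
and the landed shell summation over two disjoint boxes
`FreeBoxPowerSavingNegative.sum_tau_box_le_of_oneArm_rpow` (BK: `τ(0,z) ≤ π(⌊(‖z‖-1)/2⌋)²`, `|∂Λ_k| ≤ 54k²`)
at `s = 1/4` gives `Σ_{Λ_R} τ_{p_c} ≤ (125 + 864 M) R^{5/2}`, i.e. X_A with `a = 1/2`.

The WEAKER sufficient transfer "box-to-bulk passage" `∃ k ≥ 1, C, ∀ R ≥ 1, Σ_{Λ_R} τ_{p_c} ≤ C · Σ_{Λ_{kR}} τ^{Λ_{kR}}_{p_c}`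
(Hutchcroft 2022, arXiv:2202.07634 p. 5: no technique is known "to pass from estimates of the form (weaker) to
full-space estimates"), which also gives X_A from S(1/2) in three lines and follows from `BoxGluing` plus the BK
escape bound, is recorded with its glue in the crux workfile `Cruxes/CritBallAverageDecay/BulkLeFreeBallSum.lean`
and deliberately NOT filed as an item.  No definitions; sorry-free; axioms propext / Classical.choice / Quot.sound.
-/

noncomputable section

namespace Summit.CriticalPhenomena.PercolationContinuityZ3.Theorems

namespace CritBallAverageDecaySplit

open MeasureTheory Finset
open Literature.Probability.Percolation Literature.Probability.LatticeModels
open Summit.CriticalPhenomena.PercolationContinuityZ3.Theses.PercTwoPointDecay (CritBallAverageDecay)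
open Summit.CriticalPhenomena.PercolationContinuityZ3.Theses.PercShatteringRace (FreeSusceptibilityPowerSaving)
open Summit.CriticalPhenomena.PercolationContinuityZ3.Theses.PercHyperscalingGluing (BoxGluing)
open Summit.CriticalPhenomena.PercolationContinuityZ3.FreeBoxPowerSavingNegative (sum_tau_box_le_of_oneArm_rpow)

/-- **S(1/2) ∧ BoxGluing ⟹ `π_{p_c}(n)² ≤ M n^{-1/2}`** for all `n ≥ 1`, with `M = C |C'| K^{5/2} ≥ 0`
(box inclusion `Λ_n ⊆ Λ_{Kn}`, `|Λ_n| = (2n+1)³ ≥ n³`). [folklore] -/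
theorem oneArmProb_sq_le_of_subs (hS : FreeSusceptibilityPowerSaving) (hB : BoxGluing) :
    ∃ M : ℝ, 0 ≤ M ∧ ∀ n : ℕ, 1 ≤ n →
      (bondPercolation (zdGraph 3) (criticalProbI 3)).real (siteToBoundary 3 n) ^ 2 ≤
        M * (n : ℝ) ^ (-(1 / 2 : ℝ)) := by
  obtain ⟨C', hS⟩ := hS
  obtain ⟨C, K, hC, hK, hB⟩ := hB
  set μ := bondPercolation (zdGraph 3) (criticalProbI 3) with hμ
  set M : ℝ := C * |C'| * (K : ℝ) ^ ((5 : ℝ) / 2) with hM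
  have hM0 : 0 ≤ M := by positivity
  refine ⟨M, hM0, fun n hn => ?_⟩
  have hn1 : (1 : ℝ) ≤ n := by exact_mod_cast hn
  have hn0 : (0 : ℝ) < n := by linarith
  have hKn : 1 ≤ K * n := by
    calc 1 = 1 * 1 := by ring
      _ ≤ K * n := Nat.mul_le_mul hK hn
  -- restricted sum over Λ_n ≤ free sum over Λ_{Kn} ≤ |C'| (Kn)^{5/2}
  have hsub : box 3 n ⊆ box 3 (K * n) := box_mono 3 (by nlinarith)
  have hfree : ∑ x ∈ box 3 n, μ.real (openConnIn (↑(box 3 (K * n)) : Set (Site 3)) 0 x) ≤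
      |C'| * ((K : ℝ) ^ ((5 : ℝ) / 2) * (n : ℝ) ^ ((5 : ℝ) / 2)) := by
    calc ∑ x ∈ box 3 n, μ.real (openConnIn (↑(box 3 (K * n)) : Set (Site 3)) 0 x)
        ≤ ∑ x ∈ box 3 (K * n), μ.real (openConnIn (↑(box 3 (K * n)) : Set (Site 3)) 0 x) :=
          Finset.sum_le_sum_of_subset_of_nonneg hsub fun _ _ _ => measureReal_nonneg
      _ ≤ C' * (((K * n : ℕ) : ℝ)) ^ ((5 : ℝ) / 2) := hS (K * n) hKn
      _ ≤ |C'| * (((K * n : ℕ) : ℝ)) ^ ((5 : ℝ) / 2) :=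
          mul_le_mul_of_nonneg_right (le_abs_self C') (Real.rpow_nonneg (by positivity) _)
      _ = |C'| * ((K : ℝ) ^ ((5 : ℝ) / 2) * (n : ℝ) ^ ((5 : ℝ) / 2)) := by
          push_cast; rw [Real.mul_rpow (by positivity) (by positivity)]
  have hcard : ((box 3 n).card : ℝ) = (2 * (n : ℝ) + 1) ^ 3 := by
    rw [card_box]; push_cast; ring
  have hcard_pos : (0 : ℝ) < (box 3 n).card := by rw [hcard]; positivity
  have hcard_ge : (n : ℝ) ^ (3 : ℝ) ≤ (box 3 n).card := by
    have h3 : (n : ℝ) ^ (3 : ℝ) = (n : ℝ) ^ (3 : ℕ) := by exact_mod_cast Real.rpow_natCast (n : ℝ) 3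
    rw [hcard, h3]
    exact pow_le_pow_left₀ hn0.le (by linarith) 3
  have hn52 : (n : ℝ) ^ ((5 : ℝ) / 2) = (n : ℝ) ^ (3 : ℝ) * (n : ℝ) ^ (-(1 / 2 : ℝ)) := by
    rw [← Real.rpow_add hn0]; norm_num
  calc μ.real (siteToBoundary 3 n) ^ 2
      ≤ C * ((box 3 n).card : ℝ)⁻¹ *
          ∑ x ∈ box 3 n, μ.real (openConnIn (↑(box 3 (K * n)) : Set (Site 3)) 0 x) := hB n hn
    _ ≤ C * ((box 3 n).card : ℝ)⁻¹ * (|C'| * ((K : ℝ) ^ ((5 : ℝ) / 2) * (n : ℝ) ^ ((5 : ℝ) / 2))) :=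
          mul_le_mul_of_nonneg_left hfree (by positivity)
    _ = M * (((box 3 n).card : ℝ)⁻¹ * (n : ℝ) ^ (3 : ℝ)) * (n : ℝ) ^ (-(1 / 2 : ℝ)) := by
          rw [hM, hn52]; ring
    _ ≤ M * 1 * (n : ℝ) ^ (-(1 / 2 : ℝ)) := by
          have h1 : ((box 3 n).card : ℝ)⁻¹ * (n : ℝ) ^ (3 : ℝ) ≤ 1 := by
            rw [inv_mul_le_iff₀ hcard_pos, mul_one]; exact hcard_ge
          exact mul_le_mul_of_nonneg_right (mul_le_mul_of_nonneg_left h1 hM0)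
            (Real.rpow_nonneg hn0.le _)
    _ = M * (n : ℝ) ^ (-(1 / 2 : ℝ)) := by ring

/-- **S(1/2) ∧ BoxGluing ⟹ a one-arm RATE at `p_c(ℤ³)`**: `π_{p_c}(m) = oneArmProb 3 (criticalProbI 3) m
≤ D m^{-1/4}` for all `m ≥ 1` (square root of `oneArmProb_sq_le_of_subs`). In particular the two pieces
together already give `θ(p_c) = 0` (`θ ≤ π_m → 0`); separately neither does. [folklore] -/
theorem oneArmProb_le_of_subs (hS : FreeSusceptibilityPowerSaving) (hB : BoxGluing) :
    ∃ D : ℝ, 0 ≤ D ∧ ∀ m : ℕ, 1 ≤ m →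
      oneArmProb 3 (criticalProbI 3) m ≤ D * (m : ℝ) ^ (-(1 / 4 : ℝ)) := by
  obtain ⟨M, hM0, h2⟩ := oneArmProb_sq_le_of_subs hS hB
  refine ⟨Real.sqrt M, Real.sqrt_nonneg M, fun m hm => ?_⟩
  have hm0 : (0 : ℝ) < m := by exact_mod_cast hm
  have hπ0 : 0 ≤ oneArmProb 3 (criticalProbI 3) m := measureReal_nonneg
  have h2m : oneArmProb 3 (criticalProbI 3) m ^ 2 ≤ M * (m : ℝ) ^ (-(1 / 2 : ℝ)) := h2 m hm
  have hsq : (Real.sqrt M * (m : ℝ) ^ (-(1 / 4 : ℝ))) ^ 2 = M * (m : ℝ) ^ (-(1 / 2 : ℝ)) := by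
    rw [mul_pow, Real.sq_sqrt hM0, ← Real.rpow_natCast ((m : ℝ) ^ (-(1 / 4 : ℝ))) 2,
      ← Real.rpow_mul hm0.le]
    norm_num
  have hrhs0 : 0 ≤ Real.sqrt M * (m : ℝ) ^ (-(1 / 4 : ℝ)) :=
    mul_nonneg (Real.sqrt_nonneg _) (Real.rpow_nonneg hm0.le _)
  exact (pow_le_pow_iff_left₀ hπ0 hrhs0 two_ne_zero).1 (h2m.trans_eq hsq.symm)

/-- **SPLIT GLUE `X_A ⇐ S(1/2) ∧ BoxGluing`** (`route edit --split CritBallAverageDecay --glue-by` this):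
the one-arm rate `π_{p_c}(m) ≤ D m^{-1/4}` (`oneArmProb_le_of_subs`) fed to the landed shell summation
`FreeBoxPowerSavingNegative.sum_tau_box_le_of_oneArm_rpow` (two disjoint boxes + BK, `τ(0,z) ≤ π(⌊(‖z‖-1)/2⌋)²`;
shells `|∂Λ_k| ≤ 54 k²`) at `s = 1/4` gives `Σ_{z ∈ Λ_R} τ_{p_c}(0,z) ≤ (125 + 864 D²) R^{3 - 1/2}` for `R ≥ 1`,
i.e. `CritBallAverageDecay` with `a = 1/2`, `C = 125 + 864 D²`. [folklore] -/
theorem critBallAverageDecay_of_subs (hS : FreeSusceptibilityPowerSaving) (hB : BoxGluing) :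
    CritBallAverageDecay := by
  obtain ⟨D, _hD0, harm⟩ := oneArmProb_le_of_subs hS hB
  refine ⟨1 / 2, 125 + 864 * D ^ 2, by norm_num, fun R hR => ?_⟩
  have hsum := sum_tau_box_le_of_oneArm_rpow (criticalProbI 3) (C := D) (s := 1 / 4)
    (by norm_num) (by norm_num) harm hR
  have hexp : (3 : ℝ) - 2 * (1 / 4) = 3 - 1 / 2 := by norm_num
  simpa only [tau_def, hexp] using hsum

end CritBallAverageDecaySplit

end Summit.CriticalPhenomena.PercolationContinuityZ3.Theorems
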